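import Summits.ResolutionOfSingularities.ResolutionOfSingularities.Theorems.EquisingularLiftEquisingularLiftNatEquinodalLiftOfCert
import HarnessLib

/-!
# [OURS · L1 W4.5(b) · EL♮(3) · door ν4, brick N-0 (JINIT at `RD := RPlus`), piece (N0-1)] THE CERTIFICATE TRANSPORT `k ≃ κ(O)`:
# ★ `exists_equinodal_lift_of_cert_of_surjective` — ✓ `exists_equinodal_lift_of_cert` for an ARBITRARY residue surjection `θ : O ↠ k`

res-L1-w45b-nose-w1 g4 (WIDTH seat D-0157 DOOR 1).  Pure algebra; DEF-FREE; no `sorry`; standard axioms.  `--supports stmt-ResolutionOfSingularities-20148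
--as helper`, counted 0.

WHY.  The (S1) supplier ✓ `Equinodal.exists_equinodal_lift_of_cert` (…NatEquinodalLiftOfCert, res-L1-w45b-nose-w1 g3) reads the certificate data over
`IsLocalRing.ResidueField O` and returns node vectors with `residue (nO i j) = v i j`; but the rung's upstairs stage (K5ᵉ engine ✓ p674976, HSUBᵉ ✓ p676659)
carries an ARBITRARY surjection `θ : O →+* k` onto the door's field `k` (with `EqCertAt₀ k 3 ℓ Z hZ` over THAT `k`).  This file transports the
polynomial data along the ring isomorphism `e : ResidueField O ≃+* k`, `e ∘ residue = θ` (`θ` surjective with kernel the maximal ideal), and returns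
the (S1) output in `θ`-currency: `map θ G = restrictToHyperplane B g`, `θ (nO i j) = v i j`, `nO i 2 = 1`, node and unit-Hessian clauses over `O`.
EL♮(3) is NOT proved; resolution of singularities in positive characteristic is NOT proved.
-/

set_option linter.dupNamespace false -- mandated namespace `Summit.<Summit>.<Problem>` of this single-conjunct summit

noncomputable section

open MvPolynomial IsLocalRing

namespace Summit.ResolutionOfSingularities.ResolutionOfSingularities.Cruxes.EquisingularLiftNat.Sections.Equinodal

/-! ## §1 The residue isomorphism of a surjection onto a field -/

section Residue

variable {O k : Type*} [CommRing O] [IsLocalRing O] [Field k] (θ : O →+* k) (hθ : Function.Surjective θ)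

include hθ in
/-- the kernel of a surjection from a local ring onto a field is the maximal ideal. [folklore] -/
theorem ker_eq_maximalIdeal_of_surjective : RingHom.ker θ = maximalIdeal O :=
  IsLocalRing.eq_maximalIdeal (RingHom.ker_isMaximal_of_surjective θ hθ)

include hθ in
/-- **The residue field of `O` identifies with `k` along `θ`**: a ring isomorphism `e : κ(O) ≃+* k` with `e (residue x) = θ x`. [folklore] -/
theorem exists_residueField_ringEquiv : ∃ e : ResidueField O ≃+* k, ∀ x : O, e (residue O x) = θ x := by
  have hker : ∀ a ∈ maximalIdeal O, θ a = 0 := fun a ha => by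
    rw [← ker_eq_maximalIdeal_of_surjective θ hθ] at ha; exact ha
  let e₀ : ResidueField O →+* k := Ideal.Quotient.lift (maximalIdeal O) θ hker
  have hsurj : Function.Surjective e₀ := fun y => by
    obtain ⟨x, rfl⟩ := hθ y
    exact ⟨residue O x, Ideal.Quotient.lift_mk (maximalIdeal O) θ hker⟩
  refine ⟨RingEquiv.ofBijective e₀ ⟨e₀.injective, hsurj⟩, fun x => ?_⟩
  exact Ideal.Quotient.lift_mk (maximalIdeal O) θ hker

end Residue

/-! ## §2 Transport of polynomial data along a ring isomorphism -/

section Transport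

variable {K L : Type*} [CommRing K] [CommRing L] (f : K →+* L)

/-- `f (eval v p) = eval (f ∘ v) (map f p)`. [folklore] -/
theorem map_eval_eq_eval_map {σ : Type*} (v : σ → K) (p : MvPolynomial σ K) :
    f (eval v p) = eval (fun j => f (v j)) (MvPolynomial.map f p) := by
  induction p using MvPolynomial.induction_on with
  | C a => simp
  | add p q hp hq => simp [hp, hq]
  | mul_X p s hp => simp [hp]

/-- `map f` commutes with the restriction to a hyperplane whose coordinate matrix is mapped along. [folklore] -/
theorem map_restrictToHyperplane {K L : Type} [Field K] [Field L] (f : K →+* L) {n : ℕ} (B : Fin (n + 1) → Fin n → K)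
    (g : MvPolynomial (Fin (n + 1)) K) :
    MvPolynomial.map f (restrictToHyperplane B g) = restrictToHyperplane (fun a j => f (B a j)) (MvPolynomial.map f g) := by
  unfold restrictToHyperplane
  induction g using MvPolynomial.induction_on with
  | C a => simp
  | add p q hp hq => simp only [map_add, hp, hq]
  | mul_X p a hp =>
    rw [map_mul, map_mul, hp, aeval_X, map_mul, map_X, map_mul, aeval_X, map_sum]
    congr 1
    exact Finset.sum_congr rfl fun j _ => by rw [map_mul, map_C, map_X]

/-- `map f (hessBlock h a b v)`-compatibility: `f (hessBlock h a b v) = hessBlock (map f h) a b (f ∘ v)`. [folklore] -/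
theorem map_hessBlock {K L : Type} [Field K] [Field L] (f : K →+* L) {n : ℕ} (h : MvPolynomial (Fin n) K) (a b : Fin n) (v : Fin n → K) :
    f (hessBlock h a b v) = hessBlock (MvPolynomial.map f h) a b (fun j => f (v j)) := by
  unfold hessBlock
  simp only [map_sub, map_mul, map_pow, map_eval_eq_eval_map f, pderiv_map]

end Transport

/-! ## §3 The (S1) junction in `θ`-currency -/

/-- ★ **`exists_equinodal_lift_of_cert` FOR AN ARBITRARY RESIDUE SURJECTION `θ : O ↠ k`.**  Same inputs as ✓ `exists_equinodal_lift_of_cert`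
but with the certificate data over the door's field `k` and `θ : O →+* k` surjective (`O` local, complete); outputs in `θ`-currency:
`G ∈ O[y₀,y₁,y₂]` homogeneous of degree `e` with `map θ G = restrictToHyperplane B g`, node vectors `nO i` with `θ ∘ nO i = v i`, `nO i 2 = 1`,
`G(nO i) = 0`, `∇G(nO i) = 0`, and the affine Hessian block at `nO i` a unit of `O`. [OURS · brick N-0 piece (N0-1); counted 0] -/
theorem exists_equinodal_lift_of_cert_of_surjective
    {O : Type} [CommRing O] [IsLocalRing O] [IsAdicComplete (IsLocalRing.maximalIdeal O) O] {k : Type} [Field k]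
    (θ : O →+* k) (hθ : Function.Surjective θ) {e δ : ℕ}
    (g : MvPolynomial (Fin (3 + 1)) k) (hg : g.IsHomogeneous e)
    (B : Fin (3 + 1) → Fin 3 → k) (c a b : Fin 3)
    (hcab : (c : ℕ) = 2 ∧ (a : ℕ) = 0 ∧ (b : ℕ) = 1) (v : Fin δ → Fin 3 → k)
    (hmarked : ∀ i, v i c = 1 ∧
      MvPolynomial.eval (v i) (restrictToHyperplane B g) = 0 ∧
      (∀ j, MvPolynomial.eval (v i) (MvPolynomial.pderiv j (restrictToHyperplane B g)) = 0) ∧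
      hessBlock (restrictToHyperplane B g) a b (v i) ≠ 0)
    (hcert : Function.Surjective (fun h : MvPolynomial.homogeneousSubmodule (Fin 3) k e =>
      fun i => MvPolynomial.eval (v i) (h : MvPolynomial (Fin 3) k))) :
    ∃ (G : MvPolynomial (Fin 3) O) (nO : Fin δ → Fin 3 → O),
      G.IsHomogeneous e ∧ MvPolynomial.map θ G = restrictToHyperplane B g ∧
      (∀ i j, θ (nO i j) = v i j) ∧ (∀ i, nO i 2 = 1) ∧
      (∀ i, MvPolynomial.eval (nO i) G = 0 ∧ ∀ j, MvPolynomial.eval (nO i) (MvPolynomial.pderiv j G) = 0) ∧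
      (∀ i, IsUnit (MvPolynomial.eval (nO i) (MvPolynomial.pderiv 0 (MvPolynomial.pderiv 0 G)) *
          MvPolynomial.eval (nO i) (MvPolynomial.pderiv 1 (MvPolynomial.pderiv 1 G))
        - MvPolynomial.eval (nO i) (MvPolynomial.pderiv 0 (MvPolynomial.pderiv 1 G)) ^ 2)) := by
  classical
  obtain ⟨eqv, heqv⟩ := exists_residueField_ringEquiv θ hθ
  -- the data over `κ(O)`
  let ι : k →+* ResidueField O := eqv.symm.toRingHom
  have hιe : ∀ x, eqv (ι x) = x := fun x => eqv.apply_symm_apply x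
  have heι : ∀ y, ι (eqv y) = y := fun y => eqv.symm_apply_apply y
  let g' : MvPolynomial (Fin (3 + 1)) (ResidueField O) := MvPolynomial.map ι g
  let B' : Fin (3 + 1) → Fin 3 → ResidueField O := fun a j => ι (B a j)
  let v' : Fin δ → Fin 3 → ResidueField O := fun i j => ι (v i j)
  have hg' : g'.IsHomogeneous e := hg.map ι
  have hres : restrictToHyperplane B' g' = MvPolynomial.map ι (restrictToHyperplane B g) :=
    (map_restrictToHyperplane ι B g).symm
  have hmarked' : ∀ i, v' i c = 1 ∧
      MvPolynomial.eval (v' i) (restrictToHyperplane B' g') = 0 ∧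
      (∀ j, MvPolynomial.eval (v' i) (MvPolynomial.pderiv j (restrictToHyperplane B' g')) = 0) ∧
      hessBlock (restrictToHyperplane B' g') a b (v' i) ≠ 0 := by
    intro i
    obtain ⟨h1, h2, h3, h4⟩ := hmarked i
    refine ⟨by simp [v', h1], ?_, fun j => ?_, ?_⟩
    · rw [hres, ← map_eval_eq_eval_map ι, h2, map_zero]
    · rw [hres, pderiv_map, ← map_eval_eq_eval_map ι, h3 j, map_zero]
    · rw [hres, ← map_hessBlock ι]
      exact fun h => h4 (by simpa using congrArg eqv h)
  have hcert' : Function.Surjective (fun h : MvPolynomial.homogeneousSubmodule (Fin 3) (ResidueField O) e =>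
      fun i => MvPolynomial.eval (v' i) (h : MvPolynomial (Fin 3) (ResidueField O))) := by
    intro t
    obtain ⟨⟨h, hh⟩, hht⟩ := hcert (fun i => eqv (t i))
    refine ⟨⟨MvPolynomial.map ι h, (mem_homogeneousSubmodule e _).mpr (((mem_homogeneousSubmodule e h).mp hh).map ι)⟩, ?_⟩
    funext i
    have hi := congrFun hht i
    simp only at hi ⊢
    rw [← map_eval_eq_eval_map ι, hi, heι]
  obtain ⟨G, nO, hG, hGg, hnO, hn2, hnode, hH⟩ := exists_equinodal_lift_of_cert g' hg' B' c a b hcab v' hmarked' hcert'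
  refine ⟨G, nO, hG, ?_, fun i j => ?_, hn2, hnode, hH⟩
  · -- `map θ G = map eqv (map residue G) = map eqv (restrictToHyperplane B' g') = restrictToHyperplane B g`
    have hθ' : θ = eqv.toRingHom.comp (residue O) := RingHom.ext fun x => (heqv x).symm
    rw [hθ', ← MvPolynomial.map_map, hGg, hres, MvPolynomial.map_map]
    have hid : eqv.toRingHom.comp ι = RingHom.id k := RingHom.ext fun x => hιe x
    rw [hid, MvPolynomial.map_id]
  · rw [← heqv, hnO]; exact hιe _

end Summit.ResolutionOfSingularities.ResolutionOfSingularities.Cruxes.EquisingularLiftNat.Sections.Equinodal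

end
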